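import Summits.BirchSwinnertonDyer.BirchSwinnertonDyer.Theorems.ByReductionTypeAtTwoMultTransportTwistedDescentKummerStrict
import Summits.BirchSwinnertonDyer.Rank1Residual.X2.TateTwistUnramifiedAtTwo
import Summits.BirchSwinnertonDyer.Rank1Residual.X2.GreenbergVatsalStrictSelmerMultiplicative
import HarnessLib

/-!
# T-42-mult in the kernel, XXXVII: the local package at the prime `2` of `E/ℚ` WITH the inertial action on
# the Tate line (`I_{ℚ_v}` acts on `C ∩ E[2^n]` through the same exponent as on `μ_{2^n}`)

Cell `bsd-2adic` (run/shared/lean/pub/bsd-2adic/), seat `bsd-2adic-t42` (BRIEF-T42), GEN 17. HONEST FRAMING: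
research route; THEOREMS ONLY (no `def`, no named fact, no instance); nothing booked; nothing re-keyed
(RC-169); BSD is not proved by any of this. PARTITION: X5@2 multiplicative GV-transport rows (K4ᵐ B1·O1; the
LOCAL statement `T2` at `2`, last open input of `hF3b` after XXX) × p = 2 — types-the-object-of; bears_on K4 items
19922 / 19923 (`--supports stmt-BirchSwinnertonDyer-19923`). Brick (e) of HOME/t42/DESIGN-T42-ADDENDUM-18.md §A18.3.

## What

`exists_tateLine_localKummer_two_inertia`: the package of file XXXII (`exists_tateLine_localKummer_two`:
one Tate line `C ⊆ E[2^∞]` at the place `v ∋ 2` of the globally minimal `E/ℚ` with multiplicative reduction at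
`2`, divisible with `#C[2] = 2`, with (i) `C`-valued cocycles of `G_K` Kummer, (ii) cocycles strict modulo `C`
Kummer, (iii) Kummer maps `C`-valued modulo a coboundary) TOGETHER WITH
(iv) **the inertial action on the line**: for every `σ` in the inertia group `I_{ℚ_v}` (`absInertia`), every
`n` and every `a : ℕ` with `σζ = ζ^a` for all `ζ ∈ μ_{2^n}(ℚ̄_v)`, one has `σ c = a • c` for every `c ∈ C`
killed by `2^n`.  Reason: `C = ι⁻¹Ψ(μ)` for the twisted Tate uniformisation `Ψ` with
`σΨ(w) = ±Ψ(σw)`, the sign being `+` iff `σ` fixes `t = √γ(E)`; at the prime `2` of a minimal model with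
multiplicative reduction `ℚ_v(t)/ℚ_v` is unramified, so inertia fixes `t`
(`TateTwistUnramifiedAtTwo.inertia_fix_sqrt_gamma_two`, Silverman *ATAEC* V Ex. 5.11); and a `c ∈ C` with
`2^n c = 0` is `Ψ(ζ)` with `ζ^{2^n} ∈ q^ℤ ∩ μ = 1`.  This is the input "`I_v` acts on the line `C ≅ μ_{2^∞} ⊗ ψ`
through the cyclotomic character (`ψ` unramified)" of the bound `#H²(ℚ_v, C_n(χ_u)) ≤ |u − 1|` (file XXXVIII).
[cite: GreenbergVatsal2000, §2 pp. 14–15] [cite: SilvermanATAEC1994, Lemma V.5.2 (c), Thm. V.5.3, Ex. 5.11]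
[cite: GreenbergLNM1716, §2 Prop. 2.4 (pp. 74–75) and pp. 75–76]
-/

set_option autoImplicit false
set_option linter.dupNamespace false

noncomputable section

open scoped Classical AddSubgroup

namespace Summit.BirchSwinnertonDyer.BirchSwinnertonDyer.Theorems.MultTransportTwistedDescent

open NumberField IsDedekindDomain Field WeierstrassCurve
  Literature.NumberTheory.GaloisRepresentations Literature.NumberTheory.EllipticCurves
  Literature.NumberTheory.EllipticCurves.GreenbergSelmer IsDedekindDomain.HeightOneSpectrum
  Literature.NumberTheory.EllipticCurves.TateCurve
  Summit.BirchSwinnertonDyer.Rank1Residual.X2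

variable (W : WeierstrassCurve ℚ) [W.IsElliptic] [W.IsGloballyMinimal] (κ : ZpExtension ℚ 2)
  {v : HeightOneSpectrum (𝓞 ℚ)}

/-- **The local package at the prime `2` of the minimal `E/ℚ` with multiplicative reduction, with the inertial
action on the Tate line** (see the module docstring): a line `C ⊆ E[2^∞]` at `v ∋ 2` (a `LocalDatum`),
`2`-divisible with `#C[2] = 2`, such that for the cyclotomic `ℤ_2`-extension `κ` and `G_K = (ker κ)_v`:
(i) every continuous `C`-valued crossed homomorphism of `G_K` into `E[2^∞]` is a Kummer coboundary;
(ii) so is every continuous crossed homomorphism of `G_K` that is a coboundary modulo `C`;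
(iii) for every subgroup `G ≤ Γ_{ℚ_v}` and point `Q`, a map `k : G → E[2^∞]` with `ι(k τ) = τQ − Q` is
`C`-valued modulo a coboundary;
(iv) every `σ ∈ I_{ℚ_v}` acting on `μ_{2^n}(ℚ̄_v)` as `ζ ↦ ζ^a` acts on `C ∩ E[2^∞][2^n]` as `c ↦ a • c`.
[cite: GreenbergLNM1716, §2 Prop. 2.4 (pp. 74–75) and pp. 75–76] [cite: GreenbergVatsal2000, §2 pp. 14–15]
[cite: SilvermanATAEC1994, Lemma V.5.2 (c), Thm. V.5.3, Ex. 5.11] -/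
theorem exists_tateLine_localKummer_two_inertia (hκ : κ.IsCyclotomic)
    (hmult : W.HasMultiplicativeReductionAtPrime 2) (hv2 : ((2 : ℕ) : 𝓞 ℚ) ∈ v.asIdeal) :
    ∃ N : LocalDatum ℚ (W.geomPrimaryTorsion 2) v,
      (∀ c ∈ N.plus, ∃ c' ∈ N.plus, 2 • c' = c) ∧
      Nat.card ↥(N.plus ⊓ (↥(W.geomPrimaryTorsion 2))[(2 : ℤ)]) = 2 ∧
      (∀ (f : localSubgroup κ.kerSubgroup (v.adicCompletion ℚ) → W.geomPrimaryTorsion 2),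
        (∀ τ, f τ ∈ N.plus) → Continuous f →
        (∀ τ₁ τ₂, f (τ₁ * τ₂) = f τ₁ + resGal (K := ℚ) (v.adicCompletion ℚ)
          (τ₁ : absoluteGaloisGroup (v.adicCompletion ℚ)) • f τ₂) →
        ∃ Q : localPoints W (v.adicCompletion ℚ),
          ∀ τ : localSubgroup κ.kerSubgroup (v.adicCompletion ℚ),
            pointsMap W (v.adicCompletion ℚ) (f τ : W.geomPoints) =
              (τ : absoluteGaloisGroup (v.adicCompletion ℚ)) • Q - Q) ∧
      (∀ (f : localSubgroup κ.kerSubgroup (v.adicCompletion ℚ) → W.geomPrimaryTorsion 2)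
        (m₀ : W.geomPrimaryTorsion 2),
        (∀ τ, f τ - (resGal (K := ℚ) (v.adicCompletion ℚ)
          (τ : absoluteGaloisGroup (v.adicCompletion ℚ)) • m₀ - m₀) ∈ N.plus) → Continuous f →
        (∀ τ₁ τ₂, f (τ₁ * τ₂) = f τ₁ + resGal (K := ℚ) (v.adicCompletion ℚ)
          (τ₁ : absoluteGaloisGroup (v.adicCompletion ℚ)) • f τ₂) →
        ∃ Q : localPoints W (v.adicCompletion ℚ),
          ∀ τ : localSubgroup κ.kerSubgroup (v.adicCompletion ℚ),
            pointsMap W (v.adicCompletion ℚ) (f τ : W.geomPoints) =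
              (τ : absoluteGaloisGroup (v.adicCompletion ℚ)) • Q - Q) ∧
      (∀ (G : Subgroup (absoluteGaloisGroup (v.adicCompletion ℚ))) (Q : localPoints W (v.adicCompletion ℚ))
        (k : G → W.geomPrimaryTorsion 2),
        (∀ τ : G, pointsMap W (v.adicCompletion ℚ) (k τ : W.geomPoints) =
          (τ : absoluteGaloisGroup (v.adicCompletion ℚ)) • Q - Q) →
        ∃ m₀ : W.geomPrimaryTorsion 2, ∀ τ : G,
          k τ - (resGal (K := ℚ) (v.adicCompletion ℚ) (τ : absoluteGaloisGroup (v.adicCompletion ℚ)) • m₀ - m₀)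
            ∈ N.plus) ∧
      (∀ σ ∈ absInertia (v.adicCompletion ℚ), ∀ (n a : ℕ),
        (∀ ζ : (AlgebraicClosure (v.adicCompletion ℚ))ˣ, ζ ^ 2 ^ n = 1 →
          Units.map (Field.absoluteGaloisGroup.toAlgEquiv (v.adicCompletion ℚ) σ :
            AlgebraicClosure (v.adicCompletion ℚ) →* AlgebraicClosure (v.adicCompletion ℚ)) ζ = ζ ^ a) →
        ∀ c ∈ N.plus, 2 ^ n • c = 0 →
          resGal (K := ℚ) (v.adicCompletion ℚ) σ • c = a • c) := by
  have hv : W.HasMultiplicativeReductionAt v :=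
    GreenbergVatsalStrictSelmerMultiplicative.hasMultiplicativeReductionAt_of_mem W 2 hmult hv2
  obtain ⟨q, t, Ψ, hq0, hq1, -, -, -, ht2, hsurj, hker, hΨσ⟩ := exists_twistedTateUniformisation_tateJ W v hv
  have hts := GreenbergVatsalTateKummer.smul_sqrt_eq_or W t ht2
  have hΦ : ∀ (σ : absoluteGaloisGroup (v.adicCompletion ℚ))
      (u : (AlgebraicClosure (v.adicCompletion ℚ))ˣ),
      σ • Ψ (Additive.ofMul u) = Ψ (Additive.ofMul (Units.map
        (Field.absoluteGaloisGroup.toAlgEquiv (v.adicCompletion ℚ) σ :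
          AlgebraicClosure (v.adicCompletion ℚ) →* AlgebraicClosure (v.adicCompletion ℚ)) u)) ∨
      σ • Ψ (Additive.ofMul u) = -Ψ (Additive.ofMul (Units.map
        (Field.absoluteGaloisGroup.toAlgEquiv (v.adicCompletion ℚ) σ :
          AlgebraicClosure (v.adicCompletion ℚ) →* AlgebraicClosure (v.adicCompletion ℚ)) u)) := by
    intro σ u
    rw [hΨσ σ u]
    split_ifs
    · exact Or.inl (one_zsmul _)
    · exact Or.inr (by rw [neg_one_zsmul])
  refine ⟨GreenbergVatsalTateDatum.tateDatum W 2 Ψ hΦ,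
    GreenbergVatsalTateDatumCofree.tateDatum_plus_divisible W 2 Ψ hΦ,
    GreenbergVatsalTateDatumCofree.natCard_tateDatum_plus_inf_torsionBy W 2 Ψ hΦ hq0 hq1
      (fun u h ↦ (hker u).1 h), ?_, ?_, ?_, ?_⟩
  · intro f hfC hfcont hfcoc
    exact exists_kummerPoint_of_cocycle_mem_plus W 2 κ Ψ t hq0 hq1 (fun u h ↦ (hker u).1 h) hΨσ hts
      _ (GreenbergVatsalTateDatum.mem_tateDatum_plus_iff hΦ) hκ f hfC hfcont hfcoc
  · intro f m₀ hfC hfcont hfcoc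
    exact exists_kummerPoint_of_cocycle_strict W 2 κ Ψ t hq0 hq1 (fun u h ↦ (hker u).1 h) hΨσ hts
      _ (GreenbergVatsalTateDatum.mem_tateDatum_plus_iff hΦ) hκ f m₀ hfC hfcont hfcoc
  · intro G Q k hk
    exact exists_sub_coboundary_mem_plus W Ψ t hq0 hq1 hker hΨσ hts hsurj _
      (GreenbergVatsalTateDatum.mem_tateDatum_plus_iff hΦ) G Q k hk
  · intro σ hσ n a hroots c hc hcn
    haveI : CharZero (v.adicCompletion ℚ) := charZero_adicCompletion v
    obtain ⟨ζ, hζfin, hζc⟩ := (GreenbergVatsalTateDatum.mem_tateDatum_plus_iff hΦ c).1 hc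
    -- `ζ ^ 2^n ∈ q^ℤ ∩ μ = 1`
    have hζn : ζ ^ 2 ^ n = 1 := by
      have h0 : Ψ (Additive.ofMul (ζ ^ 2 ^ n)) = 0 := by
        rw [ofMul_pow, map_nsmul, hζc, ← map_nsmul, ← AddSubmonoidClass.coe_nsmul, hcn, ZeroMemClass.coe_zero,
          map_zero]
      exact GreenbergVatsalTateKummerLocal.eq_one_of_isOfFinOrder_of_map_eq_zero W Ψ (fun u h ↦ (hker u).1 h)
        hq0 hq1 (hζfin.pow) h0
    -- inertia fixes `t` at the prime `2`
    have hσt : Field.absoluteGaloisGroup.toAlgEquiv (v.adicCompletion ℚ) σ t = t :=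
      TateTwistUnramifiedAtTwo.inertia_fix_sqrt_gamma_two W hmult hv2 t ht2 σ hσ
    apply GreenbergVatsalTateDatumCofree.pointsMap_coe_injective W 2 (v := v)
    dsimp only
    rw [primaryComponent.coe_smul, pointsMap_smul, AddSubmonoidClass.coe_nsmul, map_nsmul, ← hζc, hΨσ σ ζ,
      if_pos hσt, one_zsmul, hroots ζ hζn, ofMul_pow, map_nsmul]

end Summit.BirchSwinnertonDyer.BirchSwinnertonDyer.Theorems.MultTransportTwistedDescent

end
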